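import Mathlib
import HarnessLib
import Summits.ResolutionOfSingularities.ResolutionOfSingularities.Theorems.WildQuotientsWildQuotientResolutionS1aQhAbsRoot
import Summits.ResolutionOfSingularities.ResolutionOfSingularities.Theorems.WildQuotientsWildQuotientResolutionS1aTparabCover

/-!
# S1a — THE QUASI-HOMOGENEOUS ROOT over an ABSTRACT node ring: the 3-COVER `(f₀ⁿ⁰, N(f₁)ⁿ¹, N(t)ⁿ²)`, its `R^w` identities, residual sections and `hrad`

[OURS · L1 W4.5c · lead-1 g16; K-LOC layer 2 for plan-1 RULING R-F15o (3) design (α1) (multi-support roots: the node of an invariant basic open `D(h)` is a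
LOCALISED polynomial ring, so the cover bookkeeping of ✓`…S1aQhCover` / ✓`…S1aTparabCover` is restated over the abstract datum of ✓`…S1aQhAbsRoot`); the tail norm
is written INTRINSICALLY as `N(t) = ∏_{j<p} τʲ t` (τ-fixed because `τᵖ = id`), so the file serves every tail] — NOT statements of the manuscript; counted 0; AI-level
work, weaker than expert review. Crux stmt-ResolutionOfSingularities-17941 `CyclicQuotientFourfolds`, line `s1a-logminvertex` v13 (`stub_reachLowerInFX`).

* cover elements in `L`: `qha_cover_zero_mem/_fixed`, `qha_norm_one_mem/_fixed`, `qha_cover_one_mem/_fixed`, `qha_iterate_tail_mem`, `qha_normTail_mem/_fixed`,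
  `qha_cover_two_mem/_fixed`;
* in `R^w`: `qha_norm_one_T`, `qha_coverElement_zero_eq` (`c₀ = u₀′ⁿ`), `qha_coverElement_one_eq` (`c₁ = (∏ᵢ(u₁′ + i·u₀′s^sh))ⁿ`), `qha_coe_sigmaR_iterate_tail`,
  `qha_coverElement_two_eq` (`c₂ = (∏ⱼ σ_Rʲ t̂)ⁿ`), ★ `qha_tail_dvd_coverElement_two` (`t̂ ∣ c₂`: the tail-norm chart is KILLED);
* residual sections: `qha_u'_zero_pow_mem_reesPiece`, `qha_residualSection_zero`, `qha_residualSection_of_mem`;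
* radical: `qha_rad_zero_one`, ★ `qha_hrad` (all `u′_l ∈ √(c₀,c₁,c₂)` as soon as `σ_Rʲ t̂ ≡ u₂′ mod (u₀′, u₁′)` for all `j` — the graph-tail condition `T(0, v) = v`).
-/

set_option linter.dupNamespace false

noncomputable section

open Literature.AlgebraicGeometry.Resolution
open scoped LaurentPolynomial
open Summit.ResolutionOfSingularities.ResolutionOfSingularities.Theorems.WildQuotientResolution.S1
open Summit.ResolutionOfSingularities.ResolutionOfSingularities.Theorems.WildQuotientResolution.S1.CoarseChart
open Summit.ResolutionOfSingularities.ResolutionOfSingularities.Theorems.WildQuotientResolution.S1.ReesBigrading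
open Summit.ResolutionOfSingularities.ResolutionOfSingularities.Theorems.WildQuotientResolution.S1.BlowupCharts
open Summit.ResolutionOfSingularities.ResolutionOfSingularities.Theorems.WildQuotientResolution.S1.GameFrame.GModel

namespace Summit.ResolutionOfSingularities.ResolutionOfSingularities.Theorems.WildQuotientResolution.S1.KillCert.QhAbs

variable {L : Type} [CommRing L] (τ : L ≃+* L) (f : Fin 3 → L) (x₃ t : L) (w : Fin 3 → ℕ) (sh : ℕ)
  (h0 : τ (f 0) = f 0) (h1 : τ (f 1) = f 1 + f 0) (hw0 : w 0 = w 1 + sh) (ht : t ∈ (weightedFiltration f w).ideal sh) {p : ℕ}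
  (hσJ : ∀ n : ℕ, ((weightedFiltration f w).ideal n).map (τ : L →+* L) ≤ (weightedFiltration f w).ideal n)

/-! ## The cover elements in `L` -/

/-- **Cover element 0**: `f₀ⁿ ∈ 𝒥_{dbar}` for `dbar = w₀·n`. -/
theorem qha_cover_zero_mem (n dbar : ℕ) (hdbar : dbar = w 0 * n) : f 0 ^ n ∈ (weightedFiltration f w).ideal dbar := by
  have h := pow_mem_weightedFiltration_ideal f w 0 n
  rwa [Nat.mul_comm, ← hdbar] at h

include h0 in
/-- Cover element 0 is `τ`-fixed. -/
theorem qha_cover_zero_fixed (n : ℕ) : τ (f 0 ^ n) = f 0 ^ n := by rw [map_pow, h0]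

include hw0 in
/-- The norm `N₁ = ∏ᵢ (f₁ + i·f₀)` lies in `𝒥_{p·w₁}`. -/
theorem qha_norm_one_mem [NeZero p] : (∏ i : ZMod p, (f 1 + (i.val : L) * f 0)) ∈ (weightedFiltration f w).ideal (p * w 1) := by
  have hX0 : f 0 ∈ (weightedFiltration f w).ideal (w 1) := (weightedFiltration _ _).antitone (show w 1 ≤ w 0 by omega) (mem_weightedFiltration_ideal f w 0)
  have hfac : ∀ i : ZMod p, f 1 + (i.val : L) * f 0 ∈ (weightedFiltration f w).ideal (w 1) :=
    fun i => add_mem (mem_weightedFiltration_ideal f w 1) (Ideal.mul_mem_left _ _ hX0)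
  have := Ideal.prod_mem_prod (s := (Finset.univ : Finset (ZMod p))) (fun i _ => hfac i)
  rw [Finset.prod_const, Finset.card_univ, ZMod.card] at this
  have hle := Veronese.idealFiltration_pow_le (weightedFiltration f w) (w 1) p
  rw [Nat.mul_comm (w 1) p] at hle
  exact hle this

include hw0 in
/-- **Cover element 1**: `N₁ⁿ ∈ 𝒥_{dbar}` for `dbar = p·w₁·n`. -/
theorem qha_cover_one_mem [NeZero p] (n dbar : ℕ) (hdbar : dbar = p * w 1 * n) : (∏ i : ZMod p, (f 1 + (i.val : L) * f 0)) ^ n ∈ (weightedFiltration f w).ideal dbar := by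
  have h := Ideal.pow_mem_pow (qha_norm_one_mem f w sh hw0 (p := p)) n
  have hle := Veronese.idealFiltration_pow_le (weightedFiltration f w) (p * w 1) n
  rw [← hdbar] at hle
  exact hle h

include h0 h1 in
/-- The norm `N₁` is `τ`-fixed (`τ` shifts the factor `i` to `i + 1`; characteristic `p ≠ 1`). -/
theorem qha_norm_one_fixed [NeZero p] [CharP L p] (hp1 : p ≠ 1) : τ (∏ i : ZMod p, (f 1 + (i.val : L) * f 0)) = ∏ i : ZMod p, (f 1 + (i.val : L) * f 0) := by
  rw [map_prod]
  have hτ : ∀ i : ZMod p, τ (f 1 + (i.val : L) * f 0) = f 1 + ((i + 1).val : L) * f 0 := by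
    intro i
    rw [map_add, map_mul, map_natCast, h1, h0]
    have hval : ((i + 1).val : L) = (i.val : L) + 1 := by
      rw [ZMod.val_add, ZMod.val_one'' hp1, ← CharP.cast_eq_mod L p (i.val + 1), Nat.cast_add, Nat.cast_one]
    rw [hval]; ring
  simp_rw [hτ]
  exact Fintype.prod_equiv (Equiv.addRight 1) _ _ fun i => rfl

include h0 h1 in
/-- Cover element 1 is `τ`-fixed. -/
theorem qha_cover_one_fixed [NeZero p] [CharP L p] (hp1 : p ≠ 1) (n : ℕ) :
    τ ((∏ i : ZMod p, (f 1 + (i.val : L) * f 0)) ^ n) = (∏ i : ZMod p, (f 1 + (i.val : L) * f 0)) ^ n := by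
  rw [map_pow, qha_norm_one_fixed τ f h0 h1 hp1]

include hσJ ht in
/-- Every iterate `τʲ t` of the tail lies in `𝒥_sh`. -/
theorem qha_iterate_tail_mem (j : ℕ) : τ^[j] t ∈ (weightedFiltration f w).ideal sh := by
  induction j with
  | zero => exact ht
  | succ j ih => rw [Function.iterate_succ_apply']; exact hσJ sh (Ideal.mem_map_of_mem _ ih)

include hσJ ht in
/-- The INTRINSIC tail norm `N(t) = ∏_{j<p} τʲ t` lies in `𝒥_{sh·p}`. -/
theorem qha_normTail_mem [NeZero p] : (∏ j : ZMod p, τ^[j.val] t) ∈ (weightedFiltration f w).ideal (sh * p) := by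
  have := Ideal.prod_mem_prod (s := (Finset.univ : Finset (ZMod p))) (fun j _ => qha_iterate_tail_mem τ f t w sh ht hσJ j.val)
  rw [Finset.prod_const, Finset.card_univ, ZMod.card] at this
  exact Veronese.idealFiltration_pow_le (weightedFiltration f w) sh p this

include hσJ ht in
/-- **Cover element 2**: `N(t)ⁿ ∈ 𝒥_{dbar}` for `dbar = sh·p·n`. -/
theorem qha_cover_two_mem [NeZero p] (n dbar : ℕ) (hdbar : dbar = sh * p * n) : (∏ j : ZMod p, τ^[j.val] t) ^ n ∈ (weightedFiltration f w).ideal dbar := by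
  have h := Ideal.pow_mem_pow (qha_normTail_mem τ f t w sh ht hσJ (p := p)) n
  have hle := Veronese.idealFiltration_pow_le (weightedFiltration f w) (sh * p) n
  rw [← hdbar] at hle
  exact hle h

/-- `τ (τ^{j.val} t) = τ^{(j+1).val} t` in `ZMod p`-indexing when `τᵖ = id`. -/
theorem iterate_val_add_one [NeZero p] (hσp : ∀ x : L, (⇑τ)^[p] x = x) (j : ZMod p) : τ (τ^[j.val] t) = τ^[(j + 1).val] t := by
  rw [← Function.iterate_succ_apply' (f := ⇑τ)]
  by_cases hj : j.val + 1 < p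
  · rw [ZMod.val_add_of_lt (by rwa [ZMod.val_one'' (by rintro rfl; simp at hj)]), ZMod.val_one'' (by rintro rfl; simp at hj)]
  · have hjp : j.val + 1 = p := by have := j.val_lt; omega
    have hj0 : j + 1 = 0 := by
      have : ((j.val + 1 : ℕ) : ZMod p) = 0 := by rw [hjp, ZMod.natCast_self]
      simpa [ZMod.natCast_val, ZMod.cast_id'] using this
    rw [hj0, ZMod.val_zero]
    show (⇑τ)^[j.val + 1] t = _
    rw [hjp, hσp]; rfl

/-- The intrinsic tail norm is `τ`-fixed. -/
theorem qha_normTail_fixed [NeZero p] (hσp : ∀ x : L, (⇑τ)^[p] x = x) : τ (∏ j : ZMod p, τ^[j.val] t) = ∏ j : ZMod p, τ^[j.val] t := by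
  rw [map_prod]
  simp_rw [iterate_val_add_one τ t hσp]
  exact Fintype.prod_equiv (Equiv.addRight 1) _ _ fun j => rfl

/-- Cover element 2 is `τ`-fixed. -/
theorem qha_cover_two_fixed [NeZero p] (hσp : ∀ x : L, (⇑τ)^[p] x = x) (n : ℕ) : τ ((∏ j : ZMod p, τ^[j.val] t) ^ n) = (∏ j : ZMod p, τ^[j.val] t) ^ n := by
  rw [map_pow, qha_normTail_fixed τ t hσp]

/-! ## The cover elements in `R^w` -/

include hw0 in
/-- `N₁·T^{p·w₁} = ∏ᵢ (u₁″ + i·(u₀″ s^sh))` in `L[T;T⁻¹]`. -/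
theorem qha_norm_one_T [NeZero p] : LaurentPolynomial.C (∏ i : ZMod p, (f 1 + (i.val : L) * f 0)) * LaurentPolynomial.T ((p * w 1 : ℕ) : ℤ) =
    ∏ i : ZMod p, (LaurentPolynomial.C (f 1) * LaurentPolynomial.T ((w 1 : ℕ) : ℤ) +
      (i.val : L[T;T⁻¹]) * (LaurentPolynomial.C (f 0) * LaurentPolynomial.T ((w 0 : ℕ) : ℤ) * LaurentPolynomial.T (-((sh : ℕ) : ℤ)))) := by
  have hfac : ∀ i : ZMod p, LaurentPolynomial.C (f 1) * LaurentPolynomial.T ((w 1 : ℕ) : ℤ) +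
      (i.val : L[T;T⁻¹]) * (LaurentPolynomial.C (f 0) * LaurentPolynomial.T ((w 0 : ℕ) : ℤ) * LaurentPolynomial.T (-((sh : ℕ) : ℤ))) =
      LaurentPolynomial.C (f 1 + (i.val : L) * f 0) * LaurentPolynomial.T ((w 1 : ℕ) : ℤ) := by
    intro i
    rw [mul_assoc, ← LaurentPolynomial.T_add, map_add, map_mul, map_natCast]
    have e1 : ((w 0 : ℕ) : ℤ) + -((sh : ℕ) : ℤ) = ((w 1 : ℕ) : ℤ) := by rw [hw0]; push_cast; ring
    rw [e1]; ring
  simp_rw [hfac]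
  rw [Finset.prod_mul_distrib, ← map_prod, Finset.prod_const, Finset.card_univ, ZMod.card, LaurentPolynomial.T_pow, mul_comm (p : ℤ)]
  push_cast
  ring_nf

variable {m : ℕ} (mo : Fin m → ℕ) (𝒜 : (Π j : Fin m, ZMod (mo j)) → AddSubgroup L) [GradedRing 𝒜] {δ : Fin 3 → Π j : Fin m, ZMod (mo j)}
  (hf : ∀ i, f i ∈ 𝒜 (δ i)) (hf0 : ∀ i, f i ∈ 𝒜 ((fun _ => (0 : Π j : Fin m, ZMod (mo j))) i))
  {dbar : ℕ} (y : ↥(𝒜 0)) (hy : y ∈ (traceFiltration 𝒜 f w).ideal dbar)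

/-- **Cover element 0 in `R^w`**: `c₀ = u₀′ⁿ` when `(y : L) = f₀ⁿ` and `dbar = w₀·n`. -/
theorem qha_coverElement_zero_eq (n : ℕ) (hdbar : dbar = w 0 * n) (hyval : (y : L) = f 0 ^ n) :
    coverElement 𝒜 f w dbar y hy = cobordantAlgebra.u' f w 0 ^ n := by
  symm
  refine Subtype.ext ?_
  rw [SubmonoidClass.coe_pow, cobordantAlgebra.coe_u', coe_coverElement, hyval, hdbar, mul_pow, ← map_pow, LaurentPolynomial.T_pow]
  congr 2
  push_cast
  ring

include hw0 in
/-- **Cover element 1 in `R^w`**: `c₁ = (∏ᵢ (u₁′ + i·(u₀′ s^sh)))ⁿ` when `(y : L) = N₁ⁿ` and `dbar = p·w₁·n`. -/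
theorem qha_coverElement_one_eq [NeZero p] (n : ℕ) (hdbar : dbar = p * w 1 * n) (hyval : (y : L) = (∏ i : ZMod p, (f 1 + (i.val : L) * f 0)) ^ n) :
    coverElement 𝒜 f w dbar y hy = (∏ i : ZMod p, (cobordantAlgebra.u' f w 1 + algebraMap L _ (i.val : L) * (cobordantAlgebra.u' f w 0 * cobordantAlgebra.s f w ^ sh))) ^ n := by
  refine Subtype.ext ?_
  rw [SubmonoidClass.coe_pow, SubmonoidClass.coe_finsetProd, coe_coverElement, hyval, hdbar]
  have hi : ∀ i : ZMod p, ((cobordantAlgebra.u' f w 1 + algebraMap L _ (i.val : L) * (cobordantAlgebra.u' f w 0 * cobordantAlgebra.s f w ^ sh) : ↥(cobordantAlgebra f w)) : L[T;T⁻¹]) =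
      LaurentPolynomial.C (f 1) * LaurentPolynomial.T ((w 1 : ℕ) : ℤ) + (i.val : L[T;T⁻¹]) * (LaurentPolynomial.C (f 0) * LaurentPolynomial.T ((w 0 : ℕ) : ℤ) * LaurentPolynomial.T (-((sh : ℕ) : ℤ))) := by
    intro i
    rw [AddMemClass.coe_add, MulMemClass.coe_mul, MulMemClass.coe_mul, cobordantAlgebra.coe_u', cobordantAlgebra.coe_u', cobordantAlgebra.coe_s_pow,
      cobordantAlgebra.coe_algebraMap, map_natCast]
  simp_rw [hi]
  rw [← qha_norm_one_T f w sh hw0 (p := p), mul_pow, ← map_pow, LaurentPolynomial.T_pow]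
  congr 2
  push_cast
  ring

section Tail

variable {p' : ℕ} (hp : 0 < p') (hσp : ∀ x : L, (⇑τ)^[p'] x = x)

/-- The iterates of `σ_R` on the tail element: `σ_Rʲ t̂ = (τʲ t)·T^sh`. -/
theorem qha_coe_sigmaR_iterate_tail (j : ℕ) :
    (((sigmaR τ f w hσJ hp hσp)^[j] ⟨_, C_mul_T_mem_cobordantAlgebra _ _ ht⟩ : ↥(cobordantAlgebra f w)) : L[T;T⁻¹]) =
      LaurentPolynomial.C (τ^[j] t) * LaurentPolynomial.T ((sh : ℕ) : ℤ) := by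
  rw [coe_sigmaR_iterate]
  induction j with
  | zero => rfl
  | succ j ih => rw [Function.iterate_succ_apply', ih, Function.iterate_succ_apply']; exact sigmaT_C_mul_T τ _ _

/-- **Cover element 2 in `R^w`**: `c₂ = (∏ⱼ σ_Rʲ t̂)ⁿ` when `(y : L) = N(t)ⁿ` (intrinsic tail norm, indexed by `ZMod p'`) and `dbar = sh·p'·n`. -/
theorem qha_coverElement_two_eq [NeZero p'] (n : ℕ) (hdbar : dbar = sh * p' * n) (hyval : (y : L) = (∏ j : ZMod p', τ^[j.val] t) ^ n) :
    coverElement 𝒜 f w dbar y hy = (∏ j : ZMod p', (sigmaR τ f w hσJ hp hσp)^[j.val] ⟨_, C_mul_T_mem_cobordantAlgebra _ _ ht⟩) ^ n := by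
  refine Subtype.ext ?_
  rw [SubmonoidClass.coe_pow, SubmonoidClass.coe_finsetProd, coe_coverElement, hyval, hdbar]
  simp_rw [qha_coe_sigmaR_iterate_tail τ f t w sh ht hσJ hp hσp]
  rw [Finset.prod_mul_distrib, ← map_prod, Finset.prod_const, Finset.card_univ, ZMod.card, LaurentPolynomial.T_pow, mul_pow, ← map_pow, LaurentPolynomial.T_pow]
  congr 2
  push_cast
  ring

include hσJ hp hσp in
/-- ★ **The tail divides the tail-norm cover element**: `t̂ ∣ c₂` (the factor `j = 0`), for `n ≥ 1`. Hence `c₂ ∈ 𝔞` and the chart of `c₂` is KILLED. -/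
theorem qha_tail_dvd_coverElement_two [NeZero p'] (n : ℕ) (hn : 0 < n) (hdbar : dbar = sh * p' * n) (hyval : (y : L) = (∏ j : ZMod p', τ^[j.val] t) ^ n) :
    (⟨_, C_mul_T_mem_cobordantAlgebra _ _ ht⟩ : ↥(cobordantAlgebra f w)) ∣ coverElement 𝒜 f w dbar y hy := by
  rw [qha_coverElement_two_eq τ f t w sh ht hσJ mo 𝒜 y hy hp hσp n hdbar hyval]
  refine dvd_trans ?_ (dvd_pow_self _ hn.ne')
  have h := Finset.dvd_prod_of_mem (fun j : ZMod p' => (sigmaR τ f w hσJ hp hσp)^[j.val] ⟨_, C_mul_T_mem_cobordantAlgebra _ _ ht⟩) (Finset.mem_univ (0 : ZMod p'))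
  rwa [ZMod.val_zero, Function.iterate_zero_apply] at h

end Tail

/-! ## Residual sections -/

include hf0 in
/-- `u₀′ⁿ` has bidegree `(w₀·n, 0)`. -/
theorem qha_u'_zero_pow_mem_reesPiece (n : ℕ) : cobordantAlgebra.u' f w 0 ^ n ∈ reesPiece 𝒜 f w ((((w 0 * n : ℕ)) : ℤ), (0 : Π j : Fin m, ZMod (mo j))) := by
  letI := reesGradedRing 𝒜 f w hf0
  have h := SetLike.pow_mem_graded n (u'_mem_reesPiece 𝒜 f (δ := fun _ => 0) w hf0 0)
  have e1 : n • ((((w 0 : ℕ)) : ℤ), (fun _ => (0 : Π j : Fin m, ZMod (mo j))) (0 : Fin 3)) = ((((w 0 * n : ℕ)) : ℤ), (0 : Π j : Fin m, ZMod (mo j))) := by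
    refine Prod.ext ?_ ?_
    · change n • (((w 0 : ℕ) : ℤ)) = (((w 0 * n : ℕ)) : ℤ); rw [nsmul_eq_mul]; push_cast; ring
    · change n • (0 : Π j : Fin m, ZMod (mo j)) = 0; exact smul_zero _
  rwa [e1] at h

include hf0 in
/-- ★ **Residual section 0** on the chart of `c = yT^{dbar}` (`dbar = w₀·n`): `u₀′ⁿ/c` has degree `0` and lies in `𝔞·R_c` for every ideal `𝔞 ∋ u₀′`. -/
theorem qha_residualSection_zero (n : ℕ) (hdbar : dbar = w 0 * n) (𝔞 : Ideal ↥(cobordantAlgebra f w)) (h𝔞 : cobordantAlgebra.u' f w 0 ∈ 𝔞) (hn : 0 < n) :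
    algebraMap _ (ChartRing 𝒜 f w dbar y hy) (cobordantAlgebra.u' f w 0 ^ n) * IsLocalization.Away.invSelf (coverElement 𝒜 f w dbar y hy) ∈ chartNodeGrading mo 𝒜 f w hf0 dbar y hy 0 ∧
      algebraMap _ (ChartRing 𝒜 f w dbar y hy) (cobordantAlgebra.u' f w 0 ^ n) * IsLocalization.Away.invSelf (coverElement 𝒜 f w dbar y hy) ∈
        𝔞.map (algebraMap _ (ChartRing 𝒜 f w dbar y hy)) := by
  refine ⟨residualSection_mem_chartNodeGrading_zero mo 𝒜 _ _ hf0 y hy ?_, residualSection_mem_map mo 𝒜 _ _ y hy (Ideal.pow_mem_of_mem 𝔞 h𝔞 _ hn)⟩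
  have h := qha_u'_zero_pow_mem_reesPiece f w mo 𝒜 hf0 n
  rwa [← hdbar] at h

include hf0 in
/-- ★ **Residual section from a second cover element**: for `y′ ∈ K_{dbar}` with `y′T^{dbar} ∈ 𝔞`, `c′/c` has degree `0` and lies in `𝔞·R_c`. -/
theorem qha_residualSection_of_mem (y' : ↥(𝒜 0)) (hy' : y' ∈ (traceFiltration 𝒜 f w).ideal dbar) (𝔞 : Ideal ↥(cobordantAlgebra f w)) (h𝔞 : coverElement 𝒜 f w dbar y' hy' ∈ 𝔞) :
    algebraMap _ (ChartRing 𝒜 f w dbar y hy) (coverElement 𝒜 f w dbar y' hy') * IsLocalization.Away.invSelf (coverElement 𝒜 f w dbar y hy) ∈ chartNodeGrading mo 𝒜 f w hf0 dbar y hy 0 ∧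
      algebraMap _ (ChartRing 𝒜 f w dbar y hy) (coverElement 𝒜 f w dbar y' hy') * IsLocalization.Away.invSelf (coverElement 𝒜 f w dbar y hy) ∈
        𝔞.map (algebraMap _ (ChartRing 𝒜 f w dbar y hy)) :=
  ⟨transitionSection_mem_chartNodeGrading_zero mo 𝒜 _ _ hf0 y hy y' hy', residualSection_mem_map mo 𝒜 _ _ y hy h𝔞⟩

/-! ## The radical condition `hrad` -/

/-- **`u₀′, u₁′ ∈ √(c)`** for any family `c` of elements of `R^w` containing `u₀′^{n₀}` and `(∏ᵢ (u₁′ + i·u₀′s^sh))^{n₁}` (`n₁ > 0`). -/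
theorem qha_rad_zero_one [NeZero p] {ι : Type} (c : ι → ↥(cobordantAlgebra f w)) (i₀ i₁ : ι) {n₀ n₁ : ℕ} (hn₁ : 0 < n₁)
    (hc₀ : c i₀ = cobordantAlgebra.u' f w 0 ^ n₀)
    (hc₁ : c i₁ = (∏ i : ZMod p, (cobordantAlgebra.u' f w 1 + algebraMap L _ (i.val : L) * (cobordantAlgebra.u' f w 0 * cobordantAlgebra.s f w ^ sh))) ^ n₁) :
    cobordantAlgebra.u' f w 0 ∈ (Ideal.span (Set.range c)).radical ∧ cobordantAlgebra.u' f w 1 ∈ (Ideal.span (Set.range c)).radical := by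
  have hX0rad : cobordantAlgebra.u' f w 0 ∈ (Ideal.span (Set.range c)).radical := ⟨n₀, by rw [← hc₀]; exact Ideal.subset_span ⟨i₀, rfl⟩⟩
  refine ⟨hX0rad, ?_⟩
  have hBrad : cobordantAlgebra.u' f w 0 * cobordantAlgebra.s f w ^ sh ∈ (Ideal.span (Set.range c)).radical := Ideal.mul_mem_right _ _ hX0rad
  have hP : (∏ i : ZMod p, (cobordantAlgebra.u' f w 1 + algebraMap L _ (i.val : L) * (cobordantAlgebra.u' f w 0 * cobordantAlgebra.s f w ^ sh))) ∈ (Ideal.span (Set.range c)).radical := by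
    refine Ideal.mem_radical_of_pow_mem (m := n₁) ?_
    rw [← hc₁]; exact Ideal.le_radical (Ideal.subset_span ⟨i₁, rfl⟩)
  have _ := hn₁
  exact Sym.mem_radical_of_prod_add_mul _ _ _ (fun i => algebraMap L _ (i.val : L)) hBrad hP

/-- ★ **`hrad` for the abstract 3-cover** `c₀ = u₀′^{n₀}`, `c₁ = (∏ᵢ (u₁′ + i·u₀′s^sh))^{n₁}`, `c₂ = (∏ⱼ gⱼ)^{n₂}` with every `gⱼ ≡ u₂′ mod (u₀′, u₁′)` (e.g. `gⱼ = σ_Rʲ t̂` for a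
graph tail): all three irrelevant generators lie in `√(c₀, c₁, c₂)`. [OURS · L1 W4.5c · K-LOC / R4 roots] -/
theorem qha_hrad [NeZero p] {κ : Type} [Fintype κ] (c : Fin 3 → ↥(cobordantAlgebra f w)) {n₀ n₁ n₂ : ℕ} (hn₁ : 0 < n₁)
    (hc₀ : c 0 = cobordantAlgebra.u' f w 0 ^ n₀)
    (hc₁ : c 1 = (∏ i : ZMod p, (cobordantAlgebra.u' f w 1 + algebraMap L _ (i.val : L) * (cobordantAlgebra.u' f w 0 * cobordantAlgebra.s f w ^ sh))) ^ n₁)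
    (g : κ → ↥(cobordantAlgebra f w)) (hg : ∀ j, g j - cobordantAlgebra.u' f w 2 ∈ Ideal.span {cobordantAlgebra.u' f w 0, cobordantAlgebra.u' f w 1})
    (hc₂ : c 2 = (∏ j, g j) ^ n₂) (l : Fin 3) :
    cobordantAlgebra.u' f w l ∈ (Ideal.span (Set.range c)).radical := by
  obtain ⟨hr0, hr1⟩ := qha_rad_zero_one f w sh (p := p) c 0 1 hn₁ hc₀ hc₁
  have hspan : Ideal.span {cobordantAlgebra.u' f w 0, cobordantAlgebra.u' f w 1} ≤ (Ideal.span (Set.range c)).radical := by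
    rw [Ideal.span_le]
    rintro x hx
    simp only [Set.mem_insert_iff, Set.mem_singleton_iff] at hx
    rcases hx with rfl | rfl
    · exact hr0
    · exact hr1
  have h2 : cobordantAlgebra.u' f w 2 ∈ (Ideal.span (Set.range c)).radical := by
    refine Tparab.mem_radical_of_prod_add _ _ (fun j => g j - cobordantAlgebra.u' f w 2) (fun j => hspan (hg j)) ?_
    simp_rw [add_sub_cancel]
    refine Ideal.mem_radical_of_pow_mem (m := n₂) ?_
    rw [← hc₂]; exact Ideal.le_radical (Ideal.subset_span ⟨2, rfl⟩)
  fin_cases l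
  · exact hr0
  · exact hr1
  · exact h2

end Summit.ResolutionOfSingularities.ResolutionOfSingularities.Theorems.WildQuotientResolution.S1.KillCert.QhAbs

end
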